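import Literature.AnabelianGeometry.SemiGraphs.TemperedReconstructionCor39Finite
import Literature.AnabelianGeometry.SemiGraphs.TemperedReconstructionCor39FactsFinite
import HarnessLib

/-!
# [SemiAnbd] Cor. 3.9, compatible reading with CHOSEN conjugators (`Cor39Compat`, F-2771) at a finite pair:
# the exact residue is "the chosen conjugator families realise every twist class"

Mochizuki, *Semi-graphs of anabelioids*, Publ. RIMS **42** (2006), §3, Corollary 3.9, manuscript p. 42
[cite: MochizukiSemiAnbd2006, Cor 3.9 p.42], with Rmk. 2.4.2 p. 26 (a morphism of semi-graphs of anabelioids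
is compatible with the branch maps "up to conjugation": the conjugating elements are not part of the data).

PROOF-ONLY file (0 definitions) of the abc-iut cell, L-F sub-cell [SemiAnbd]+[CombGC] pack A, FACT-LIST row
F-2771 `ProfiniteSemiGraph.Cor39Compat` (L3-lead ruling β3, seat abc-iut-w6-d099).  The tree holds, for every
pair of FINITE graphs of anabelioids satisfying the hypotheses of Cor. 3.9: the named twin up to twist
(`cor39CompatUpToTwistAt_of_finite`, abc-iut-w4-d064/w4-d080: "induced" = `Hom.InducesUpToTwist`, i.e.
`B^temp(φ) ≅ F^*_θ` for SOME admissible family `θ` of conjugating elements) and clause (a) for the CHOSEN family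
(`cor39_a_of_finiteGraph`).  `Cor39Compat` itself phrases (b) with `Hom.Induces`, i.e. with the family
`Hom.chosenConjugators F := (Classical.choose of F.comm)`, a function of the DATA `(F.base, F.hV, F.hE)` only.
This file proves that, at a finite pair, the body of `Cor39Compat` is EQUIVALENT to the following statement
and to nothing more:

  (CR) for every locally open `F` and every `φ` induced by `F` up to twist, SOME locally open `F'` with the
  same underlying morphism of semi-graphs induces `φ` for ITS chosen family —

`cor39CompatAt_iff_chosenRealisesTwists` (and the two directions by name).  (CR) is a statement about the
VALUES of the choice function on the propositions `F'.comm b v h`: at the estranged loop graph `loopGraph p`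
(abc-iut-w5-d236) every such proposition has at least `p` admissible witnesses with pairwise NON-isomorphic
twisted pull-backs (`IwahoriWitness.toZMod_eq_of_hom`, `TemperedReconstructionR3Refutation.lean`, whence
`not_inducesOfCompatible`), so neither (CR) nor its negation is settled by anything the tree can prove about
`loopGraph p` — recorded here as a REMARK for the L-F table (row F-2771: re-key to `Cor39CompatUpToTwist`,
a theorem at finite pairs), not as a theorem.  Nothing here bears on [IUTchIII] Cor. 3.12; typed ≠ proved.
-/

open CategoryTheory

namespace Literature.AnabelianGeometry.SemiGraphs

namespace ProfiniteSemiGraph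

universe u

variable {𝒢 ℋ : ProfiniteSemiGraph.{u}}

/-- **(CR) ⇒ `Cor39Compat` at a finite pair.**  If, at the finite pair `(G, H)`, every homomorphism induced up
to twist by a locally open `F` is induced, for the CHOSEN conjugator family, by some locally open `F'` with
`F'.base = F.base`, then the body of `Cor39Compat` holds at `(G, H)`: (a) is `cor39_a_of_finiteGraph`; (b) is
the up-to-twist Cor. 3.9 (`cor39CompatUpToTwistAt_of_finite`) followed by (CR), uniqueness of vertex and edge
maps coming from the up-to-twist uniqueness of the underlying morphism (`Hom.inducesUpToTwist_of_induces`).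
[cite: MochizukiSemiAnbd2006, Cor 3.9 p.42] -/
theorem cor39CompatAt_of_chosenRealisesTwists [Finite 𝒢.graph.Vertex] [Finite 𝒢.graph.Edge]
    [Finite ℋ.graph.Vertex] [Finite ℋ.graph.Edge] (h𝒢 : Cor39Hypotheses 𝒢) (hℋ : Cor39Hypotheses ℋ)
    (c𝒢 : TemperedPiChart 𝒢) (cℋ : TemperedPiChart ℋ)
    (hCR : ∀ (F : Hom 𝒢 ℋ) (φ : c𝒢.G →ₜ* cℋ.G), F.IsLocallyOpen → F.InducesUpToTwist c𝒢 cℋ φ →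
      ∃ F' : Hom 𝒢 ℋ, F'.IsLocallyOpen ∧ F'.base = F.base ∧ F'.Induces c𝒢 cℋ φ) :
    (∀ (F : Hom 𝒢 ℋ), F.IsLocallyOpen → ∀ φ : c𝒢.G →ₜ* cℋ.G, F.Induces c𝒢 cℋ φ →
        IsQuasiGeometric φ) ∧
      ∀ φ : c𝒢.G →ₜ* cℋ.G, IsCompatiblyQuasiGeometric φ →
        ∃ F : Hom 𝒢 ℋ, F.IsLocallyOpen ∧ F.Induces c𝒢 cℋ φ ∧
          ∀ F' : Hom 𝒢 ℋ, F'.IsLocallyOpen → F'.Induces c𝒢 cℋ φ →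
            F'.base.vertexMap = F.base.vertexMap ∧ F'.base.edgeMap = F.base.edgeMap := by
  refine ⟨fun F hF φ hind => cor39_a_of_finiteGraph h𝒢 hℋ c𝒢 cℋ F hF φ hind, fun φ hφ => ?_⟩
  obtain ⟨F₀, hF₀, htw₀, huniq₀⟩ := (cor39CompatUpToTwistAt_of_finite h𝒢 hℋ c𝒢 cℋ).2 φ hφ
  obtain ⟨F', hF', hbase, hind'⟩ := hCR F₀ φ hF₀ htw₀
  refine ⟨F', hF', hind', fun F'' hF'' hind'' => ?_⟩
  have h'' : F''.base = F₀.base :=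
    huniq₀ F'' hF'' (F''.inducesUpToTwist_of_induces c𝒢 cℋ φ hind'')
  rw [hbase, h'']
  exact ⟨rfl, rfl⟩

/-- **`Cor39Compat` at a finite pair ⇒ (CR).**  Conversely, if the body of `Cor39Compat` holds at the finite
pair `(G, H)`, then every `φ` induced up to twist by a locally open `F` is compatibly quasi-geometric
(`cor39CompatUpToTwistAt_of_finite`, clause (a)), hence by (b) induced for the chosen family by some locally
open `F'`; and `F'.base = F.base` by the up-to-twist uniqueness of the underlying morphism.
[cite: MochizukiSemiAnbd2006, Cor 3.9 p.42] -/
theorem chosenRealisesTwists_of_cor39CompatAt [Finite 𝒢.graph.Vertex] [Finite 𝒢.graph.Edge]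
    [Finite ℋ.graph.Vertex] [Finite ℋ.graph.Edge] (h𝒢 : Cor39Hypotheses 𝒢) (hℋ : Cor39Hypotheses ℋ)
    (c𝒢 : TemperedPiChart 𝒢) (cℋ : TemperedPiChart ℋ)
    (h : (∀ (F : Hom 𝒢 ℋ), F.IsLocallyOpen → ∀ φ : c𝒢.G →ₜ* cℋ.G, F.Induces c𝒢 cℋ φ →
        IsQuasiGeometric φ) ∧
      ∀ φ : c𝒢.G →ₜ* cℋ.G, IsCompatiblyQuasiGeometric φ →
        ∃ F : Hom 𝒢 ℋ, F.IsLocallyOpen ∧ F.Induces c𝒢 cℋ φ ∧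
          ∀ F' : Hom 𝒢 ℋ, F'.IsLocallyOpen → F'.Induces c𝒢 cℋ φ →
            F'.base.vertexMap = F.base.vertexMap ∧ F'.base.edgeMap = F.base.edgeMap)
    (F : Hom 𝒢 ℋ) (φ : c𝒢.G →ₜ* cℋ.G) (hF : F.IsLocallyOpen) (htw : F.InducesUpToTwist c𝒢 cℋ φ) :
    ∃ F' : Hom 𝒢 ℋ, F'.IsLocallyOpen ∧ F'.base = F.base ∧ F'.Induces c𝒢 cℋ φ := by
  have hcq : IsCompatiblyQuasiGeometric φ := (cor39CompatUpToTwistAt_of_finite h𝒢 hℋ c𝒢 cℋ).1 F hF φ htw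
  obtain ⟨F', hF', hind', -⟩ := h.2 φ hcq
  obtain ⟨F₀, -, -, huniq₀⟩ := (cor39CompatUpToTwistAt_of_finite h𝒢 hℋ c𝒢 cℋ).2 φ hcq
  have h1 : F.base = F₀.base := huniq₀ F hF htw
  have h2 : F'.base = F₀.base := huniq₀ F' hF' (F'.inducesUpToTwist_of_induces c𝒢 cℋ φ hind')
  exact ⟨F', hF', h2.trans h1.symm, hind'⟩

/-- **The exact residue of `Cor39Compat` (F-2771) at a finite pair.**  For FINITE `G`, `H` satisfying the
hypotheses of [SemiAnbd] Cor. 3.9 and any charts, the body of the named fact `Cor39Compat` at `(G, H)` —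
(a) induced (chosen family) ⇒ quasi-geometric, (b) compatibly quasi-geometric ⇒ induced (chosen family) by a
locally open morphism unique on vertices and edges — holds IF AND ONLY IF the chosen conjugator families realise
every twist class: (CR) every `φ` induced up to twist by a locally open `F` is induced, for the chosen family,
by some locally open `F'` with the same underlying morphism of semi-graphs.  Everything else in `Cor39Compat`
at the pair is the theorem `cor39CompatUpToTwistAt_of_finite`. [cite: MochizukiSemiAnbd2006, Cor 3.9 p.42] -/
theorem cor39CompatAt_iff_chosenRealisesTwists [Finite 𝒢.graph.Vertex] [Finite 𝒢.graph.Edge]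
    [Finite ℋ.graph.Vertex] [Finite ℋ.graph.Edge] (h𝒢 : Cor39Hypotheses 𝒢) (hℋ : Cor39Hypotheses ℋ)
    (c𝒢 : TemperedPiChart 𝒢) (cℋ : TemperedPiChart ℋ) :
    ((∀ (F : Hom 𝒢 ℋ), F.IsLocallyOpen → ∀ φ : c𝒢.G →ₜ* cℋ.G, F.Induces c𝒢 cℋ φ →
        IsQuasiGeometric φ) ∧
      ∀ φ : c𝒢.G →ₜ* cℋ.G, IsCompatiblyQuasiGeometric φ →
        ∃ F : Hom 𝒢 ℋ, F.IsLocallyOpen ∧ F.Induces c𝒢 cℋ φ ∧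
          ∀ F' : Hom 𝒢 ℋ, F'.IsLocallyOpen → F'.Induces c𝒢 cℋ φ →
            F'.base.vertexMap = F.base.vertexMap ∧ F'.base.edgeMap = F.base.edgeMap) ↔
    ∀ (F : Hom 𝒢 ℋ) (φ : c𝒢.G →ₜ* cℋ.G), F.IsLocallyOpen → F.InducesUpToTwist c𝒢 cℋ φ →
      ∃ F' : Hom 𝒢 ℋ, F'.IsLocallyOpen ∧ F'.base = F.base ∧ F'.Induces c𝒢 cℋ φ :=
  ⟨fun h F φ hF htw => chosenRealisesTwists_of_cor39CompatAt h𝒢 hℋ c𝒢 cℋ h F φ hF htw,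
    fun hCR => cor39CompatAt_of_chosenRealisesTwists h𝒢 hℋ c𝒢 cℋ hCR⟩

/-- **Consequence for the ∀-closure.**  `Cor39Compat` implies (CR) at every pair of finite graphs satisfying
the hypotheses of Cor. 3.9 (universe `u`); in particular any kernel decision of the named fact `Cor39Compat`
decides (CR) at the estranged loop graph, a statement about the values of the chosen conjugators there.
[cite: MochizukiSemiAnbd2006, Cor 3.9 p.42] -/
theorem chosenRealisesTwists_of_cor39Compat (h : Cor39Compat.{u}) [Finite 𝒢.graph.Vertex]
    [Finite 𝒢.graph.Edge] [Finite ℋ.graph.Vertex] [Finite ℋ.graph.Edge] (h𝒢 : Cor39Hypotheses 𝒢)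
    (hℋ : Cor39Hypotheses ℋ) (c𝒢 : TemperedPiChart 𝒢) (cℋ : TemperedPiChart ℋ) (F : Hom 𝒢 ℋ)
    (φ : c𝒢.G →ₜ* cℋ.G) (hF : F.IsLocallyOpen) (htw : F.InducesUpToTwist c𝒢 cℋ φ) :
    ∃ F' : Hom 𝒢 ℋ, F'.IsLocallyOpen ∧ F'.base = F.base ∧ F'.Induces c𝒢 cℋ φ :=
  chosenRealisesTwists_of_cor39CompatAt h𝒢 hℋ c𝒢 cℋ (h 𝒢 ℋ h𝒢 hℋ c𝒢 cℋ) F φ hF htw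

end ProfiniteSemiGraph

end Literature.AnabelianGeometry.SemiGraphs
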